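import Mathlib
import HarnessLib
import Literature.Computability.AlgebraicComplexity.FlatteningBound
import Literature.Computability.AlgebraicComplexity.AsymptoticSpectrum
import Literature.Computability.AlgebraicComplexity.AlderStrassen
import Literature.Computability.AlgebraicComplexity.BigCwFourthOmega
import Literature.Computability.AlgebraicComplexity.QuantumFunctionals
import Literature.Computability.AlgebraicComplexity.QuantumFunctionalsDegenerationProofs
import Literature.Computability.AlgebraicComplexity.AsymptoticRankMatMul
import Literature.Computability.AlgebraicComplexity.AsymptoticRankConjecture
import Literature.Computability.AlgebraicComplexity.TensorRestrictionRank
import Literature.Computability.AlgebraicComplexity.RankMethodBarriers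
import Literature.Barriers.MatrixMultiplication.UniversalMethodBarrierAsymptoticRank

/-!
# ObstructionDescent — the obstruction calculus, PART 1 of 5: `ObstructionCalculusAction`

LANDING SPLIT (decomp-mm-lander-1 g1, 2026-08-30; mechanical, for the 400-line lint; REQUESTS #16-ii, decomp-mm SUMMON
Tier 3 (10)) of «Part 1 + Part 1b — the obstruction calculus on cubic tensor formats» of the lens-3 gen-8 kernel
`DegreeFiltration_g8_tree.lean` (sha256 `132d565c…aec8`, 2383 lines; critic-CLEARED decomp-mm STATUS l.348/365; rc0, the
calculus parts sorry-free).  This file = «Action» (GL³/Mat³ action on cubic tensors), «Padding», «MatMul» + the `Idx`/`Tensor` bookkeeping (source lines 198–346),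
copied byte-identically inside the source namespace `Summit.MatrixMultiplication.MatrixMultiplication.Theorems.ObstructionCalculus`
with the source header (`noncomputable section`, opens).  Route-free: imports Literature / the previous part only, NO `Theses`
file (lint `theses-cone`).  The five parts Action → Invariants → Slots → PadInheritance → Locality form one import chain and
SUPPORT the crux `NoOccurrenceObstruction` (item `stmt-MatrixMultiplication-29040`, route-MatrixMultiplication-ObstructionDescent)
WITHOUT closing anything; nothing here proves ω = 2.  Full mathematical commentary: the module docstring of the source kernel
(HOME/decomp-mm-lens-3/pkg-ObstructionDescent-g8/) and the docstrings below.
-/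

set_option linter.dupNamespace false
set_option autoImplicit false

noncomputable section

open scoped BigOperators
open Filter Asymptotics Finset

namespace Summit.MatrixMultiplication.MatrixMultiplication.Theorems

namespace ObstructionCalculus

open Literature.Computability.AlgebraicComplexity (triad triad_apply tensorRank matMulTensor unitTensor
  unitTensor_apply exists_eq_sum_triad_of_tensorRank_le actTensor actTensor_apply actTensor_zero actTensor_triad)

/-- Coordinates of the cubic tensor space `R^m ⊗ R^m ⊗ R^m`. [bookkeeping] -/
abbrev Idx (m : ℕ) : Type := Fin m × Fin m × Fin m

/-- Cubic 3-tensors of format `m` with entries in `R`. [bookkeeping] -/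
abbrev Tensor (R : Type*) (m : ℕ) : Type _ := Fin m → Fin m → Fin m → R

section Action

variable {R : Type*} [CommRing R] {m : ℕ}

/-! The substitution action `((A,B,C)·t)_{abc} = Σ_{ijk} A_{ai} B_{bj} C_{ck} t_{ijk}` of a triple of
`m × m` matrices on a cubic tensor (Bürgisser–Ikenmeyer 2011, §2 (2.1)) is the tree's
`Literature.Computability.AlgebraicComplexity.actTensor` (with `actTensor_triad`: triads transform
factorwise). -/

/-- `[A|B|C] := Σ_l A_{•l} ⊗ B_{•l} ⊗ C_{•l}`: the tensor with the COLUMNS of `A, B, C` as triad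
factors — the image of the unit tensor `⟨m⟩` under `(A,B,C)` (`actTensor_unitTensor`), so that
`{[A|B|C]} = Mat_m³ · ⟨m⟩ ⊇ GL_m³ · ⟨m⟩` is exactly the set of tensors of rank `≤ m` in format `m`.
[cite: BurgisserIkenmeyer2011, §2 (2.2)] -/
def fromCols (A B C : Matrix (Fin m) (Fin m) R) : Tensor R m :=
  ∑ l : Fin m, triad (fun a => A a l) (fun b => B b l) (fun c => C c l)

/-- `(Σf)(Σg)(Σh) = Σ_i Σ_j Σ_k f_i g_j h_k` (fixed nesting order). [bookkeeping] -/
theorem sum_mul_sum_mul_sum {ι : Type*} [Fintype ι] (f g h : ι → R) :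
    (∑ i, f i) * (∑ j, g j) * (∑ k, h k) = ∑ i, ∑ j, ∑ k, f i * g j * h k := by
  rw [Finset.sum_mul_sum, Finset.sum_mul]
  refine Finset.sum_congr rfl fun i _ => ?_
  rw [Finset.sum_mul]
  refine Finset.sum_congr rfl fun j _ => ?_
  rw [Finset.mul_sum]

/-- A sum over `ι³` as an iterated sum. [bookkeeping] -/
theorem sum_idx3 {ι : Type*} [Fintype ι] {M : Type*} [AddCommMonoid M] (F : ι × ι × ι → M) :
    ∑ p : ι × ι × ι, F p = ∑ i, ∑ j, ∑ k, F (i, j, k) := by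
  rw [Fintype.sum_prod_type]
  exact Finset.sum_congr rfl fun i _ => Fintype.sum_prod_type _

/-- The action is additive in the tensor. [folklore] -/
theorem actTensor_add' (A B C : Matrix (Fin m) (Fin m) R) (s t : Tensor R m) :
    actTensor A B C (s + t) = actTensor A B C s + actTensor A B C t := by
  funext a b c
  simp only [actTensor_apply, Pi.add_apply, mul_add, Finset.sum_add_distrib]

/-- The action is additive over finite sums of tensors. [folklore] -/
theorem actTensor_finset_sum' {σ : Type*} (A B C : Matrix (Fin m) (Fin m) R) (s : Finset σ)
    (f : σ → Tensor R m) : actTensor A B C (∑ x ∈ s, f x) = ∑ x ∈ s, actTensor A B C (f x) := by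
  classical
  induction s using Finset.induction_on with
  | empty => simp
  | insert x s hx ih => rw [Finset.sum_insert hx, Finset.sum_insert hx, actTensor_add', ih]

/-- `(A,B,C)·[A'|B'|C'] = [AA'|BB'|CC']`. [bookkeeping] -/
theorem actTensor_fromCols (A B C A' B' C' : Matrix (Fin m) (Fin m) R) :
    actTensor A B C (fromCols A' B' C') = fromCols (A * A') (B * B') (C * C') := by
  unfold fromCols
  rw [actTensor_finset_sum']
  refine Finset.sum_congr rfl fun l _ => ?_
  rw [actTensor_triad]
  rfl

/-- `⟨m⟩ = [1|1|1]`. [bookkeeping] -/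
theorem unitTensor_eq_fromCols : unitTensor R m = fromCols (1 : Matrix (Fin m) (Fin m) R) 1 1 := by
  funext a b c
  simp only [fromCols, Finset.sum_apply, triad_apply, unitTensor_apply]
  rw [Finset.sum_eq_single a]
  · by_cases hab : a = b
    · subst hab
      by_cases hac : a = c
      · subst hac; simp
      · simp [hac, Matrix.one_apply_ne' hac]
    · simp [hab, Matrix.one_apply_ne' hab]
  · intro l _ hl
    simp [Matrix.one_apply_ne hl.symm]
  · simp

/-- `(A,B,C)·⟨m⟩ = [A|B|C]`. [cite: BurgisserIkenmeyer2011, §2 (2.2)] -/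
theorem actTensor_unitTensor (A B C : Matrix (Fin m) (Fin m) R) :
    actTensor A B C (unitTensor R m) = fromCols A B C := by
  rw [unitTensor_eq_fromCols, actTensor_fromCols, Matrix.mul_one, Matrix.mul_one, Matrix.mul_one]

end Action

section Padding

variable {R : Type*} [CommRing R] {m : ℕ} {ι : Type} [Fintype ι]

/-- Zero-padding of a vector along an index map `e : ι → Fin m`. [bookkeeping] -/
def padVec (e : ι → Fin m) (x : ι → R) : Fin m → R :=
  fun a => ∑ i, (if e i = a then 1 else 0) * x i

/-- Zero-padding of a 3-tensor on `ι³` into the cubic format `m` along `e : ι → Fin m`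
(Bürgisser–Ikenmeyer 2011, §2: a format is enlarged by zero-padding). [cite: BurgisserIkenmeyer2011, §2] -/
def padTensor (e : ι → Fin m) (t : ι → ι → ι → R) : Tensor R m :=
  fun a b c => ∑ p : ι × ι × ι,
    (if e p.1 = a ∧ e p.2.1 = b ∧ e p.2.2 = c then 1 else 0) * t p.1 p.2.1 p.2.2

/-- Padding a triad gives the triad of the padded vectors. [bookkeeping] -/
theorem padTensor_triad (e : ι → Fin m) (w u v : ι → R) :
    padTensor e (triad w u v) = triad (padVec e w) (padVec e u) (padVec e v) := by
  funext a b c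
  change ∑ p : ι × ι × ι, (if e p.1 = a ∧ e p.2.1 = b ∧ e p.2.2 = c then 1 else 0) *
      (w p.1 * u p.2.1 * v p.2.2) =
    (∑ i, (if e i = a then 1 else 0) * w i) * (∑ j, (if e j = b then 1 else 0) * u j) *
      (∑ k, (if e k = c then 1 else 0) * v k)
  rw [sum_mul_sum_mul_sum, sum_idx3]
  refine Finset.sum_congr rfl fun i _ => Finset.sum_congr rfl fun j _ =>
    Finset.sum_congr rfl fun k _ => ?_
  by_cases h₁ : e i = a <;> by_cases h₂ : e j = b <;> by_cases h₃ : e k = c <;> simp [h₁, h₂, h₃]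

/-- Padding is additive over finite sums. [bookkeeping] -/
theorem padTensor_sum {σ : Type*} (e : ι → Fin m) (s : Finset σ) (f : σ → ι → ι → ι → R) :
    padTensor e (∑ x ∈ s, f x) = ∑ x ∈ s, padTensor e (f x) := by
  funext a b c
  simp only [padTensor, Finset.sum_apply, Finset.mul_sum]
  exact Finset.sum_comm

end Padding

section MatMul

variable (R : Type*) [CommRing R]

/-- The index embedding `Fin n × Fin n ↪ Fin m` (`(i,j) ↦ i·n + j`) for `n² ≤ m`. [bookkeeping] -/
def padIdx (n m : ℕ) (h : n * n ≤ m) : Fin n × Fin n → Fin m :=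
  fun q => Fin.castLE h (finProdFinEquiv q)

/-- `pad_m⟨n,n,n⟩`: the matrix multiplication tensor `⟨n,n,n⟩ ∈ R^{n²} ⊗ R^{n²} ⊗ R^{n²}` zero-padded
into the cubic format `m ≥ n²` (Bürgisser–Ikenmeyer 2011, §2 and §5: the "matrix multiplication versus
unit tensor problem" compares `pad_m⟨n,n,n⟩` with `⟨m⟩`). [cite: BurgisserIkenmeyer2011, §5] -/
def padMM (n m : ℕ) (h : n * n ≤ m) : Tensor R m :=
  padTensor (padIdx n m h) (matMulTensor R n n n)

variable {R}

/-- If `R(⟨n,n,n⟩) ≤ m` and `n² ≤ m` then `pad_m⟨n,n,n⟩ = [A|B|C]` for some `A, B, C ∈ Mat_m(R)`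
(the columns are the zero-padded factors of a length-`m` decomposition), i.e. `pad_m⟨n,n,n⟩ ∈ Mat_m³·⟨m⟩`.
[cite: BurgisserIkenmeyer2011, §2 (2.2)] -/
theorem exists_fromCols_eq_padMM {n m : ℕ} (h : n * n ≤ m)
    (hr : tensorRank (matMulTensor R n n n) ≤ m) :
    ∃ A B C : Matrix (Fin m) (Fin m) R, padMM R n m h = fromCols A B C := by
  obtain ⟨w, u, v, hdec⟩ := exists_eq_sum_triad_of_tensorRank_le hr
  refine ⟨fun a l => padVec (padIdx n m h) (w l) a, fun b l => padVec (padIdx n m h) (u l) b,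
    fun c l => padVec (padIdx n m h) (v l) c, ?_⟩
  unfold padMM
  rw [hdec, padTensor_sum]
  simp only [padTensor_triad]
  rfl

end MatMul

end ObstructionCalculus

end Summit.MatrixMultiplication.MatrixMultiplication.Theorems

end
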